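import Mathlib
import Literature.Computability.AlgebraicComplexity.PermanentIrreducible
import Literature.Computability.AlgebraicComplexity.StandardFamiliesProofs
import Summits.ValiantsHypothesis.ValiantsHypothesis.Theorems.DivisionGapPerCofactorDegreeReductionStubSquareDescent

/-!
# Crux `DivisionGap.PerCofactorDegreeReduction` (stmt-ValiantsHypothesis-15046), line `Sketch` —
# stub `stub_realNullstellensatzPer`: `(per_n)` is a real ideal of `ℝ[x_ij]`

**Theorem (`stub_realNullstellensatzPer`).** Let `n ≥ 1` and let `F ∈ ℝ[x_ij]` (`n × n`
variables) vanish on the REAL zero set of the permanent `per_n = perPoly (Fin n) ℝ`.  Then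
`per_n ∣ F`.  In the line this is why relation varieties of real light gates have Zariski-dense
real points and why positive-definite forms descend; it generalises `stub_squareDescent`, whose
pseudo-division mechanism (`SquareDescent.exists_pow_mul_sub_free`,
`SquareDescent.eq_zero_of_dvd_of_degreeOf`) is reused verbatim.

## Proof

Everything holds for an arbitrary prime `p ∈ ℝ[x]` of degree exactly `1` in some variable `X_e`
(`dvd_of_forall_eval_eq_zero`); for `per_n` take `e = (0, 0)` (`degreeOf_perPoly`,
`perPoly_irreducible`, and `ℝ[x]` in finitely many variables is a UFD).
1. `p = X_e · a + b` with `a = p /ᵐ X_e`, `b = p %ᵐ X_e` free of `X_e`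
   (`MvPolynomial.divMonomial_add_modMonomial_single`), `a ≠ 0` since `degreeOf e p = 1`, and
   `p ∤ a` (an `X_e`-free multiple of `p` vanishes, `SquareDescent.eq_zero_of_dvd_of_degreeOf`).
2. Pseudo-division (`SquareDescent.exists_pow_mul_sub_free`): `p ∣ a ^ D · F - U` with `U` free
   of `X_e`, say `a ^ D · F - U = p · Q`.
3. `a · U = 0`: compare evaluations at every real point `y` (`MvPolynomial.funext`, `ℝ` is
   infinite).  If `a(y) = 0` this is clear.  Otherwise move the `e`-coordinate of `y` to
   `-b(y) / a(y)`; the values of the `X_e`-free polynomials `a, b, U` do not change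
   (`eval_update_eq_of_degreeOf`), the new point `x` is a real zero of `p = X_e · a + b`, so
   `F(x) = 0` by hypothesis, hence `U(x) = a(x) ^ D · F(x) - p(x) · Q(x) = 0`, i.e. `U(y) = 0`.
4. `ℝ[x]` is a domain and `a ≠ 0`, so `U = 0` and `p ∣ a ^ D · F`; `p` prime and `p ∤ a` give
   `p ∣ F` (`Prime.dvd_of_dvd_pow`, `Prime.dvd_or_dvd`).

Leans on the tree only: `degreeOf_perPoly`, `perPoly_irreducible`, the `SquareDescent`
pseudo-division lemmas; Mathlib (`MvPolynomial.funext`, `MvPolynomial.eval₂Hom_congr'`).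
No definitions.
-/

noncomputable section

-- `Summit.ValiantsHypothesis.ValiantsHypothesis.…` is the tree's mandated single-conjunct layout
-- (Problem = Summit), so the duplicated namespace component is intended.
set_option linter.dupNamespace false

namespace Summit.ValiantsHypothesis.ValiantsHypothesis.Theorems.DivisionGap.PerCofactorDegreeReduction.RealNullstellensatzPer

open MvPolynomial Literature.Computability.AlgebraicComplexity

/-! ### Evaluation and `X_e`-free polynomials -/

/-- The value of an `X_e`-free polynomial does not depend on the `e`-coordinate of the point.
[folklore] -/
theorem eval_update_eq_of_degreeOf {σ : Type*} [DecidableEq σ] {R : Type*} [CommRing R]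
    {e : σ} {g : MvPolynomial σ R} (h : degreeOf e g = 0) (y : σ → R) (t : R) :
    eval (Function.update y e t) g = eval y g := by
  -- adapted from `eval_update_eq_of_degreeOf` in
  -- `Summits/Schanuel/…/DiophantineDichotomyApproximationPropertyCurveHilbertGenericSection.lean`
  change eval₂Hom (RingHom.id R) _ g = eval₂Hom (RingHom.id R) _ g
  refine eval₂Hom_congr' rfl (fun i hi _ => Function.update_of_ne ?_ _ _) rfl
  rintro rfl
  exact (mem_vars_iff_degreeOf_ne_zero.mp hi) h

/-! ### A prime of degree one in some variable generates a real ideal -/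

/-- A prime `p ∈ ℝ[x]` of degree exactly `1` in some variable `X_e` divides every real polynomial
vanishing on the real zero set of `p`: the ideal `(p)` is real. [folklore] -/
theorem dvd_of_forall_eval_eq_zero {σ : Type*} [DecidableEq σ] {p : MvPolynomial σ ℝ}
    (hprime : Prime p) {e : σ} (hpe : degreeOf e p = 1) (F : MvPolynomial σ ℝ)
    (hF : ∀ x : σ → ℝ, eval x p = 0 → eval x F = 0) : p ∣ F := by
  -- Step 1: `p = X_e · a + b`, `a, b` free of `X_e`, `a ≠ 0`, `p ∤ a`.
  obtain ⟨a, b, hp, ha, hb⟩ : ∃ a b : MvPolynomial σ ℝ,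
      X e * a + b = p ∧ degreeOf e a = 0 ∧ degreeOf e b = 0 :=
    ⟨_, _, p.divMonomial_add_modMonomial_single e, by
      have := SquareDescent.degreeOf_divMonomial_single_le e p
      omega, SquareDescent.degreeOf_modMonomial_single e p⟩
  have hpe' : degreeOf e p ≠ 0 := by omega
  have ha0 : a ≠ 0 := by
    rintro rfl
    rw [mul_zero, zero_add] at hp
    rw [← hp, hb] at hpe
    exact zero_ne_one hpe
  have hpa : ¬ p ∣ a := fun h => ha0 (SquareDescent.eq_zero_of_dvd_of_degreeOf hpe' ha h)
  -- Step 2: pseudo-division, `a ^ D · F - U = p · Q` with `U` free of `X_e`.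
  obtain ⟨D, U, hU, Q, hQ⟩ :=
    SquareDescent.exists_pow_mul_sub_free hp ha hb (degreeOf e F) F le_rfl
  -- Step 3: `a · U = 0` by comparing evaluations at every real point.
  have haU : a * U = 0 := by
    apply MvPolynomial.funext
    intro y
    rw [map_zero, map_mul]
    by_cases hay : eval y a = 0
    · rw [hay, zero_mul]
    · -- move the `e`-coordinate of `y` to the root of `p(y with X_e := T) = T · a(y) + b(y)`
      have key : ∀ g : MvPolynomial σ ℝ, degreeOf e g = 0 →
          eval (Function.update y e (-eval y b / eval y a)) g = eval y g :=
        fun g hg => eval_update_eq_of_degreeOf hg y _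
      have hxp : eval (Function.update y e (-eval y b / eval y a)) p = 0 := by
        rw [← hp, map_add, map_mul, eval_X, key a ha, key b hb, Function.update_self,
          div_mul_cancel₀ _ hay, neg_add_cancel]
      have hxQ := congrArg (eval (Function.update y e (-eval y b / eval y a))) hQ
      simp only [map_sub, map_mul] at hxQ
      rw [hF _ hxp, hxp, key U hU] at hxQ
      have hyU : eval y U = 0 := by linear_combination -hxQ
      rw [hyU, mul_zero]
  -- Step 4: `U = 0`, so `p ∣ a ^ D · F`, and `p ∤ a ^ D`.
  have hU0 : U = 0 := (mul_eq_zero.1 haU).resolve_left ha0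
  have h1 : p ∣ a ^ D * F := ⟨Q, by rw [← hQ, hU0, sub_zero]⟩
  rcases hprime.dvd_or_dvd h1 with h | h
  · exact absurd (hprime.dvd_of_dvd_pow h) hpa
  · exact h

/-! ### The stub -/

/-- **stub_realNullstellensatzPer — `(per_n)` IS A REAL IDEAL.**  For `n ≥ 1`, a real polynomial
`F` vanishing on the real zero set of the permanent `per_n = perPoly (Fin n) ℝ` is a multiple of
`per_n`.  `per_n` is prime in `ℝ[x]` (`perPoly_irreducible`, UFD) of degree `1` in `X_{(0,0)}`
(`degreeOf_perPoly`), and `dvd_of_forall_eval_eq_zero` applies. [folklore] -/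
theorem stub_realNullstellensatzPer (n : ℕ) (hn : 1 ≤ n) (F : MvPolynomial (Fin n × Fin n) ℝ)
    (hF : ∀ x : Fin n × Fin n → ℝ, MvPolynomial.eval x (perPoly (Fin n) ℝ) = 0 →
      MvPolynomial.eval x F = 0) :
    perPoly (Fin n) ℝ ∣ F := by
  haveI : Nonempty (Fin n) := ⟨⟨0, hn⟩⟩
  have hprime : Prime (perPoly (Fin n) ℝ) :=
    UniqueFactorizationMonoid.irreducible_iff_prime.mp perPoly_irreducible
  exact dvd_of_forall_eval_eq_zero hprime
    (degreeOf_perPoly ℝ ((⟨0, hn⟩ : Fin n), (⟨0, hn⟩ : Fin n))) F hF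

end Summit.ValiantsHypothesis.ValiantsHypothesis.Theorems.DivisionGap.PerCofactorDegreeReduction.RealNullstellensatzPer

end
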